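import Summits.ResolutionOfSingularities.ResolutionOfSingularities.Theorems.EquisingularLiftEquisingularLiftNatFirstOrderTransport
import HarnessLib

/-!
# [OURS] ★★★ FIRST-ORDER POINTS IN LINEARLY GENERAL POSITION — matrix form, free charts: EL♮ (cruxes 20038 / 20148) and regular blow-up models (crux 15660)

[OURS · leafhand-res-equisingularlift-9 g0, 2026-08-31; cell `pub/decomp-res`] AI-produced, weaker than expert review; NOT a statement of any manuscript;
nothing here proves resolution of singularities.  DEF-FREE helper; no `sorry`; standard axioms; ZERO named hypotheses.

* `FirstOrderPoint.firstOrderData_linSubst_of_matrix` — the first-order data of the normalised form `σ_B F` at its marked vertices, from the translated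
  charts of `F` at the marked columns of `B` (✓ `firstOrder_linSubst_of_translatedChart₂`, ✓ `firstOrder_of_forall_aeval`);
* ★★★ `FirstOrderPoint.elNatAt_of_firstOrderPoints_matrix₂` — **EL♮ (`Theorems.EquisingularLift.ELNatAt`) for every `(H, ι)` (`range ι = V₊(F)`, `F` a prime
  form, `K = K̄` of characteristic `p`, ANY dimension, ANY degree) whose singular points are marked columns of ONE invertible matrix `B` (linearly general
  position), each a FIRST-ORDER point — chart `Φ_μ + Ψ_{μ+1} + (y)^{μ+2}` with `Φ(v) = ∇Φ(v) = Ψ_{μ+1}(v) = 0` only for `v = 0`, i.e. resolved by ONE blow-up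
  with non-singular strict transform along the exceptional divisor — read in a chart `c₀(c)` with `B_{c₀(c),c} = 1`**: witness `O = 𝕎(K)`, ONE blow-up of
  `ℙ_O` along the product of the `O`-points through the marked points.  Strictly contains leafhand-7 g1's ✓ `MultiOrd.elNatAt_of_ordinaryPoints_matrix₂`
  (ordinary points: `Ψ_{μ+1}` not needed); new: `A₂` points, characteristic-2 nodes, and their higher-dimensional / higher-multiplicity analogues;
* ★★★ `StrataSplit.blowupModel_of_firstOrderPoints_matrix₂` — the same in the currency of crux 15660 (regular blow-up model = conclusion of the OPEN residual
  `stub_blowupModel_ge_five` at `H`).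

Honest label: closes no registered stub of 20038 / 20148 / 15660; EL♮(3) / EL♮ / EL are NOT proved.

References: [Hartshorne1977, I Thm. 5.1, I Ex. 5.8, II Example 7.1.1, II Ex. 7.12]; [StacksProject, Tag 080A]; [Matsumura1987, §14].
-/

set_option linter.dupNamespace false -- mandated namespace `Summit.<Summit>.<Problem>` of this single-conjunct summit

noncomputable section

open CategoryTheory CategoryTheory.Limits AlgebraicGeometry TopologicalSpace
open MvPolynomial
open Literature.AlgebraicGeometry.Resolution
open Literature.AlgebraicGeometry.Motives Literature.AlgebraicGeometry.Motives.SmoothHypersurface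
open Literature.AlgebraicGeometry.Motives.ProjectiveSpace
open Summit.ResolutionOfSingularities.ResolutionOfSingularities.Cruxes.EquisingularLift.StrataSplit

namespace Summit.ResolutionOfSingularities.ResolutionOfSingularities.Cruxes.EquisingularLiftNat.Sections

namespace FirstOrderPoint

open MultiOrd

variable {K : Type} [Field K]

/-! ## ★★★ Matrix form with free charts -/

/-- **The first-order data of the normalised form at its marked vertices** (the shared step of the two matrix theorems): `B ∈ GL_{m+3}(K)`, chart choice
`c₀` with `B_{c₀(c),c} = 1`, (foF) the translated charts of `F` at the marked columns with the closed-point first-order criterion (`K = K̄`); then the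
vertex charts of `σ_{B}F` at `c ∈ S` carry first-order data with the prime-ideal criterion (✓ `firstOrder_of_forall_aeval`,
`firstOrder_linSubst_of_translatedChart₂`). [cite: Hartshorne1977, II Example 7.1.1] -/
theorem firstOrderData_linSubst_of_matrix [IsAlgClosed K] {m : ℕ} (F : MvPolynomial (Fin (m + 2 + 1)) K) {d : ℕ} (hF : F.IsHomogeneous d)
    (B : Matrix (Fin (m + 2 + 1)) (Fin (m + 2 + 1)) K) (hB : IsUnit B.det)
    (S : List (Fin (m + 2 + 1))) (c₀ : Fin (m + 2 + 1) → Fin (m + 2 + 1)) (hB1 : ∀ c ∈ S, B (c₀ c) c = 1)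
    (hfoF : ∀ c ∈ S, ∃ (μ : ℕ) (Φ Ψ₁ Ψ' : MvPolynomial (Fin (m + 2)) K), 1 ≤ μ ∧ Φ.IsHomogeneous μ ∧ Φ ≠ 0 ∧ Ψ₁.IsHomogeneous (μ + 1) ∧
      Ψ' ∈ Ideal.span (Set.range (X : Fin (m + 2) → MvPolynomial (Fin (m + 2)) K)) ^ (μ + 2) ∧
        aeval (fun j : Fin (m + 2) => (X j : MvPolynomial (Fin (m + 2)) K) + C (B ((c₀ c).succAbove j) c))
          (ProjectiveSpace.dehomogenize K (c₀ c) F) = Φ + (Ψ₁ + Ψ') ∧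
      ∀ v : Fin (m + 2) → K, aeval v Φ = 0 → (∀ i, aeval v (pderiv i Φ) = 0) → aeval v Ψ₁ = 0 → v = 0)
    (c : Fin (m + 2 + 1)) (hc : c ∈ S) :
    ∃ (μ : ℕ) (Φ Ψ₁ Ψ' : MvPolynomial (Fin (m + 2)) K), 1 ≤ μ ∧ Φ.IsHomogeneous μ ∧ Φ ≠ 0 ∧ Ψ₁.IsHomogeneous (μ + 1) ∧
      Ψ' ∈ Ideal.span (Set.range (X : Fin (m + 2) → MvPolynomial (Fin (m + 2)) K)) ^ (μ + 2) ∧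
      ProjectiveSpace.dehomogenize K c (aeval B.toMvPolynomial F) = Φ + (Ψ₁ + Ψ') ∧
      ∀ P : Ideal (MvPolynomial (Fin (m + 2)) K), P.IsPrime → Φ ∈ P → (∀ i, pderiv i Φ ∈ P) → Ψ₁ ∈ P →
        ∀ i, (X i : MvPolynomial (Fin (m + 2)) K) ∈ P := by
  obtain ⟨μ, Φ, Ψ₁, Ψ', hμ, hΦ, hΦ0, hΨ₁, hΨ', heq, hv⟩ := hfoF c hc
  obtain ⟨Φ', Ψ₁', Ψ'', hΦ', hΦ'0, hΨ₁', hΨ'', heq', hfo'⟩ := firstOrder_linSubst_of_translatedChart₂ c (c₀ c)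
    (B⁻¹).toMvPolynomial B.toMvPolynomial (Matrix.toMvPolynomial_isHomogeneous _) (Matrix.toMvPolynomial_isHomogeneous _)
    (aeval_toMvPolynomial_inv_toMvPolynomial B hB) (aeval_toMvPolynomial_toMvPolynomial_inv B hB)
    (fun l => B l c) (hB1 c hc) (fun i => by rw [eval_single_toMvPolynomial, eval_single_toMvPolynomial, hB1 c hc, one_mul]) F hF hΦ hΦ0 hΨ₁ hΨ'
    (fun P hP hΦP hdP hΨP => firstOrder_of_forall_aeval K Φ Ψ₁ hv P hP hΦP hdP hΨP) heq
  exact ⟨μ, Φ', Ψ₁', Ψ'', hμ, hΦ', hΦ'0, hΨ₁', hΨ'', heq', hfo'⟩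

/-- ★★★ **EL♮ for hypersurfaces whose singular points are FIRST-ORDER points in linearly general position — matrix form, free charts.**  `K = K̄` of
characteristic `p`; `ι : H ↪ ℙ^{m+2}_K`, `range ι = V₊(F)`, `F` a prime form; `B ∈ GL_{m+3}(K)`, `S` duplicate-free; for each `c ∈ S` a chart index `c₀ c` with
`B_{c₀(c), c} = 1`; (foF) the chart `F(x_{c₀ c} := 1)` translated to `P_c = [B_{·c}]` reads `Φ_c + (Ψ_{1,c} + Ψ'_c)`, `Φ_c ≠ 0` a form of degree `μ_c ≥ 1`,
`Ψ_{1,c}` a form of degree `μ_c + 1`, `Ψ'_c ∈ (y)^{μ_c+2}`, with `Φ_c(v) = ∇Φ_c(v) = Ψ_{1,c}(v) = 0` only for `v = 0` (FIRST-ORDER point: the strict transform under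
the blow-up of `P_c` is non-singular along the exceptional divisor); (jacF) every `b ≠ 0` with `F(b) = 0`, `∇F(b) = 0` is `s·B_{·c}` for some `c ∈ S`.  Then
`Theorems.EquisingularLift.ELNatAt p K (m+2) H ι`: `O = 𝕎(K)`, ONE blow-up of `ℙ^{m+2}_O` along the product of the `O`-points through the `P_c`.  Contains
✓ `MultiOrd.elNatAt_of_ordinaryPoints_matrix₂` (ordinary points) and, classically, every cubic surface with only `A₁`/`A₂` points, every characteristic.
[OURS] [cite: Hartshorne1977, I Thm. 5.1, II Example 7.1.1] [cite: StacksProject, Tag 080A] -/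
theorem elNatAt_of_firstOrderPoints_matrix₂ (p : ℕ) (hp : p.Prime) [CharP K p] [IsAlgClosed K] {m : ℕ}
    {H : Scheme.{0}} (ι : H ⟶ (projectiveSpace (m + 1 + 1) K).left) [IsClosedImmersion ι]
    (F : MvPolynomial (Fin (m + 1 + 1 + 1)) K) {d : ℕ} (hF : F.IsHomogeneous d) (hFp : Prime F)
    (hrange : letI := MvPolynomial.gradedAlgebra (σ := Fin (m + 1 + 1 + 1)) (R := K)
      Set.range ι = {x : Proj (homogeneousSubmodule (Fin (m + 1 + 1 + 1)) K) | F ∈ x.asHomogeneousIdeal})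
    (B : Matrix (Fin (m + 1 + 1 + 1)) (Fin (m + 1 + 1 + 1)) K) (hB : IsUnit B.det)
    (S : List (Fin (m + 2 + 1))) (hS : S.Nodup) (c₀ : Fin (m + 2 + 1) → Fin (m + 2 + 1)) (hB1 : ∀ c ∈ S, B (c₀ c) c = 1)
    (hfoF : ∀ c ∈ S, ∃ (μ : ℕ) (Φ Ψ₁ Ψ' : MvPolynomial (Fin (m + 2)) K), 1 ≤ μ ∧ Φ.IsHomogeneous μ ∧ Φ ≠ 0 ∧ Ψ₁.IsHomogeneous (μ + 1) ∧
      Ψ' ∈ Ideal.span (Set.range (X : Fin (m + 2) → MvPolynomial (Fin (m + 2)) K)) ^ (μ + 2) ∧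
        aeval (fun j : Fin (m + 2) => (X j : MvPolynomial (Fin (m + 2)) K) + C (B ((c₀ c).succAbove j) c))
          (ProjectiveSpace.dehomogenize K (c₀ c) F) = Φ + (Ψ₁ + Ψ') ∧
      ∀ v : Fin (m + 2) → K, aeval v Φ = 0 → (∀ i, aeval v (pderiv i Φ) = 0) → aeval v Ψ₁ = 0 → v = 0)
    (hjacF : ∀ b : Fin (m + 2 + 1) → K, b ≠ 0 → eval b F = 0 → (∀ j, eval b (pderiv j F) = 0) →
      ∃ c ∈ S, ∃ s : K, b = s • fun l => B l c) :
    Theorems.EquisingularLift.ELNatAt p K (m + 1 + 1) H ι := by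
  have hτ := Matrix.toMvPolynomial_isHomogeneous (B⁻¹)
  have hτ' := Matrix.toMvPolynomial_isHomogeneous B
  have hinv := aeval_toMvPolynomial_inv_toMvPolynomial B hB
  have hinv' := aeval_toMvPolynomial_toMvPolynomial_inv B hB
  have hG : (aeval B.toMvPolynomial F).IsHomogeneous d := by
    have h := hF.aeval B.toMvPolynomial hτ'
    rwa [one_mul] at h
  have hGp : Prime (aeval B.toMvPolynomial F) := prime_aeval_of_linSubst (B⁻¹).toMvPolynomial B.toMvPolynomial hinv hinv' hFp
  have hjac := MultiOrd.jacobian_of_linSubst (B⁻¹).toMvPolynomial B.toMvPolynomial hτ hinv hinv' S F (fun b hb h0 hd => by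
    obtain ⟨c, hc, s, rfl⟩ := hjacF b hb h0 hd
    exact ⟨c, hc, fun i hi => eval_toMvPolynomial_inv_eq_zero B hB c s i hi⟩)
  exact QuadricELNat.elNatAt_of_elNatAt_linSubst (B⁻¹).toMvPolynomial B.toMvPolynomial hτ hτ' hinv hinv' p ι F hrange
    (elNatAt_firstOrderPoints p hp K (aeval B.toMvPolynomial F) hG hGp S hS
      (fun c hc => firstOrderData_linSubst_of_matrix F hF B hB S c₀ hB1 hfoF c hc)
      (fun c _ P hP hf hPj j => MultiOrd.hsing_of_jacobian (aeval B.toMvPolynomial F) hG S hjac c P hP hf hPj j)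
      (fun c hc => MultiOrd.isRegularRing_chartRing_of_jacobian (aeval B.toMvPolynomial F) hG S hjac hGp c hc))

end FirstOrderPoint

end Summit.ResolutionOfSingularities.ResolutionOfSingularities.Cruxes.EquisingularLiftNat.Sections

namespace Summit.ResolutionOfSingularities.ResolutionOfSingularities.Cruxes.EquisingularLift.StrataSplit

open Summit.ResolutionOfSingularities.ResolutionOfSingularities.Cruxes.EquisingularLiftNat.Sections
open Summit.ResolutionOfSingularities.ResolutionOfSingularities.Cruxes.EquisingularLiftNat

/-- ★★★ **Regular blow-up models for hypersurfaces whose singular points are FIRST-ORDER points in linearly general position — matrix form, free charts**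
(`K = K̄`, any characteristic / dimension / degree): hypotheses of ✓ `FirstOrderPoint.elNatAt_of_firstOrderPoints_matrix₂`; conclusion = that of the OPEN
residual `stub_blowupModel_ge_five` of crux `EquisingularLift` at `H` (✓ `blowupModel_firstOrderPoints` for `σ_B F`, carried along `α_{B⁻¹}`).
[cite: Hartshorne1977, I Thm. 5.1, II Example 7.1.1, II Ex. 7.12] -/
theorem blowupModel_of_firstOrderPoints_matrix₂ {K : Type} [Field K] [IsAlgClosed K] {m : ℕ} {H : Scheme.{0}}
    (ι : H ⟶ (projectiveSpace (m + 1 + 1) K).left) [IsClosedImmersion ι] [IsIntegral H]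
    (F : MvPolynomial (Fin (m + 1 + 1 + 1)) K) {d : ℕ} (hF : F.IsHomogeneous d) (hFp : Prime F)
    (hrange : letI := MvPolynomial.gradedAlgebra (σ := Fin (m + 1 + 1 + 1)) (R := K)
      Set.range ι = {x : Proj (homogeneousSubmodule (Fin (m + 1 + 1 + 1)) K) | F ∈ x.asHomogeneousIdeal})
    (B : Matrix (Fin (m + 1 + 1 + 1)) (Fin (m + 1 + 1 + 1)) K) (hB : IsUnit B.det)
    (S : List (Fin (m + 2 + 1))) (hS : S.Nodup) (c₀ : Fin (m + 2 + 1) → Fin (m + 2 + 1)) (hB1 : ∀ c ∈ S, B (c₀ c) c = 1)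
    (hfoF : ∀ c ∈ S, ∃ (μ : ℕ) (Φ Ψ₁ Ψ' : MvPolynomial (Fin (m + 2)) K), 1 ≤ μ ∧ Φ.IsHomogeneous μ ∧ Φ ≠ 0 ∧ Ψ₁.IsHomogeneous (μ + 1) ∧
      Ψ' ∈ Ideal.span (Set.range (X : Fin (m + 2) → MvPolynomial (Fin (m + 2)) K)) ^ (μ + 2) ∧
        aeval (fun j : Fin (m + 2) => (X j : MvPolynomial (Fin (m + 2)) K) + C (B ((c₀ c).succAbove j) c))
          (ProjectiveSpace.dehomogenize K (c₀ c) F) = Φ + (Ψ₁ + Ψ') ∧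
      ∀ v : Fin (m + 2) → K, aeval v Φ = 0 → (∀ i, aeval v (pderiv i Φ) = 0) → aeval v Ψ₁ = 0 → v = 0)
    (hjacF : ∀ b : Fin (m + 2 + 1) → K, b ≠ 0 → eval b F = 0 → (∀ j, eval b (pderiv j F) = 0) →
      ∃ c ∈ S, ∃ s : K, b = s • fun l => B l c) :
    ∃ 𝔞 : H.IdealSheafData, 𝔞 ≠ ⊥ ∧ ∀ (Z : Scheme.{0}) (π : Z ⟶ H), IsBlowup π 𝔞 → Scheme.IsRegular Z := by
  letI := MvPolynomial.gradedAlgebra (σ := Fin (m + 1 + 1 + 1)) (R := K)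
  have hτ := Matrix.toMvPolynomial_isHomogeneous (B⁻¹)
  have hτ' := Matrix.toMvPolynomial_isHomogeneous B
  have hinv := MultiOrd.aeval_toMvPolynomial_inv_toMvPolynomial B hB
  have hinv' := MultiOrd.aeval_toMvPolynomial_toMvPolynomial_inv B hB
  have hG : (aeval B.toMvPolynomial F).IsHomogeneous d := by
    have h := hF.aeval B.toMvPolynomial hτ'
    rwa [one_mul] at h
  have hGp : Prime (aeval B.toMvPolynomial F) := prime_aeval_of_linSubst (B⁻¹).toMvPolynomial B.toMvPolynomial hinv hinv' hFp
  have hjac := MultiOrd.jacobian_of_linSubst (B⁻¹).toMvPolynomial B.toMvPolynomial hτ hinv hinv' S F (fun b hb h0 hd => by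
    obtain ⟨c, hc, s, rfl⟩ := hjacF b hb h0 hd
    exact ⟨c, hc, fun i hi => MultiOrd.eval_toMvPolynomial_inv_eq_zero B hB c s i hi⟩)
  obtain ⟨ι₁, hι₁, hrange₁⟩ := exists_closedImmersion_range_eq_of_linSubst (B⁻¹).toMvPolynomial B.toMvPolynomial hτ hτ' hinv hinv' ι F hrange
  haveI := hι₁
  exact blowupModel_of_range_eq ι₁ (aeval B.toMvPolynomial F) hG hGp hrange₁
    (blowupModel_firstOrderPoints K (aeval B.toMvPolynomial F) hG hGp S hS
      (fun c hc => FirstOrderPoint.firstOrderData_linSubst_of_matrix F hF B hB S c₀ hB1 hfoF c hc)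
      (fun c _ P hP hf hPj j => MultiOrd.hsing_of_jacobian (aeval B.toMvPolynomial F) hG S hjac c P hP hf hPj j)
      (fun c hc => MultiOrd.isRegularRing_chartRing_of_jacobian (aeval B.toMvPolynomial F) hG S hjac hGp c hc))

end Summit.ResolutionOfSingularities.ResolutionOfSingularities.Cruxes.EquisingularLift.StrataSplit

end
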